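import Summits.BirchSwinnertonDyer.Rank1Residual.X5.KummerRelaxedStrictCount
import Summits.BirchSwinnertonDyer.Rank1Residual.X11b.LocalPrimaryCohomologyEP
import Summits.BirchSwinnertonDyer.BirchSwinnertonDyer.Theorems.ByReductionTypeAtTwoSupersingularFlatBlindCardPositionLocal
import HarnessLib

/-!
# Route `ByReductionTypeAtTwo` (rung K4), crux `SupersingularRankZeroAtTwo` (item stmt-BirchSwinnertonDyer-19097), line
# `odd_blind_package` (registry v2.10.1), slot 5 `stub_CD` = CDC_H, binder `hglob` of the position glue ★★ p816472
# `OddBlindLocal.position_of_complement_of_lineCount (hloc) (hglob)` = (P1) + (P2): **THIS FILE IS (P1) — THE POITOU–TATE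
# COUNT «relaxed-vs-strict at `v ∣ p`», MODULO the print binder `hPT`** (cell `bsd-2adic`, seat `bsd-2adic-t42` GEN 42, hand h10;
# LEAD memo `HOME/ss/gen21/HAND-TARGETS-CDC-4.md` ADDENDUM 4c, scratch `HANDTARGETS_CDC4_GEN21.lean` :63–73)

THEOREM ONLY (no definition, no named fact, no instance, no `sorry`); `--supports stmt-BirchSwinnertonDyer-19097 --as helper`;
imports: Theorems / `Rank1Residual` tool modules only; closes nothing; typed ≠ proved; BSD is proved for no curve by it.
CONDITIONAL on the print binder `hPT : poitouTate_selmerStructure_duality_real ℚ` (Milne *ADT* I Thm. 4.10 (b) + Ex. 1.6 (c): the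
Poitou–Tate family of local invariant maps with `IsPerfect`, `SumLocalTermEqZero`, `SelmerComplement` and injectivity at the REAL
place — director-bsd (764)(A)(i) / (783)(B): carried OPENLY as the FIRST explicit hypothesis, never discharged here).  The second
admissible print binder `hEP` (Tate's local Euler–Poincaré characteristic, Milne I Thm. 2.8) is NOT NEEDED: the tree PROVES it at every
completion `ℚ_v` (`X11b.LocBridge.localEulerPoincareCharacteristic_adicCompletionEP`, from n1011's `GaloisImage.EPCTate`).

★ `HTC7globPT_natCard_kummerRelaxed_eq (hPT)`: for every elliptic curve `E/ℚ`, prime `p`, finite place `v ∋ p` with `E(ℚ_v)[p] = 0`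
(the hand also carries `E(ℚ)[p] = 0`, unused), and every `J ≥ 1`,
**`#H¹_{𝓚^{v}}(ℚ, E[p^J]) = p^J · #H¹_{𝓚_{v}}(ℚ, E[p^J])`**, where `𝓚^{v} = KummerPT.kummerRelaxed E (p^J) {v}` / `𝓚_{v} =
KummerPT.kummerStrict E (p^J) {v}` are the Kummer (`p^J`-descent) Selmer structure of `E[p^J]` made `⊤` / `⊥` at `v` (Kummer at every
other place, the real place included; `X11b/KummerRelaxedStructures.lean`).
PROOF (Wiles–Greenberg / DDT Thm. 2.19: `(#H¹_𝓡/#H¹_𝓢)² = #A_J`, the `∞`-factors of the two dual formulas cancel, also at `p = 2`).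
The tree's X5 KUMMER COUNT `SelfDualCount.relIndex_kummerStrict_kummerRelaxed_singleton_eq` (b2b `x11b3-p9`: Poitou–Tate in counting
form `natCard_selmerQuotient_mul_of_poitouTate` for `𝓚_{v} ≤ 𝓚^{v}` + the Kummer structure is residually SELF-DUAL at EVERY place under
Sakamoto's Weil transport — finite places by Tate local duality + EP, complex places trivially, REAL places by archimedean Tate
duality GIVEN the injectivity of `inv_∞` on `Br(ℝ)[n]`, which is exactly `hPT`'s fifth conjunct `InjectiveAtRealPlaces`) gives
`[H¹_{𝓚^{v}} : H¹_{𝓚_{v}}] = #E(ℚ_v)[p^J] · #(𝓞_v / p^J)`; `E(ℚ_v)[p] = 0 ⟹ E(ℚ_v)[p^J] = 0`; `#(𝓞_v/p^J) = p^J` (`𝓞_v ≅ ℤ_p`,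
`OddBlindLocal.natCard_adicCompletionIntegers_quotient_span_pow`); and `#H¹_{𝓚_{v}} · [H¹_{𝓚^{v}} : H¹_{𝓚_{v}}] = #H¹_{𝓚^{v}}`
(`AddSubgroup.relIndex_mul_relIndex` with `⊥ ≤ H¹_{𝓚_{v}} ≤ H¹_{𝓚^{v}}`).  With the LEAD's (P2) `HTC7globAlg_…` the glue binder `hglob`
closes by `fun E _ p _ v hv h0v h0p h0 hr hsha ↦ P2 E p v hv h0v h0p h0 hr hsha (HTC7globPT_natCard_kummerRelaxed_eq hPT E p v hv h0v h0)`.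
bears_on: K4 (19097). 19097 OPEN; CDC_H not claimed.

References: [MilneADT2006] I Ex. 1.6 (c), Thm. 2.8, Thm. 2.13, Cor. 3.4, Rem. 3.7, Thm. 4.10, Lemma 6.15; [Howard2004HeegnerKolyvagin]
Thm. 2.1.11 (arXiv:1202.6340 p. 6); [DDTFermat1997] Thm. 2.19; [GreenbergLNM1716] §3–4; [Sakamoto2024] §3.1.2; [SilvermanAEC2009] III.8.1.
-/

set_option autoImplicit false
set_option linter.dupNamespace false

noncomputable section

open scoped Classical NumberField AddSubgroup ContRepresentation

namespace Summit.BirchSwinnertonDyer.BirchSwinnertonDyer.Theorems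

namespace OddBlindLocal

open NumberField IsDedekindDomain Field Function WeierstrassCurve Literature.NumberTheory.EllipticCurves
open Literature.NumberTheory.GaloisRepresentations Literature.NumberTheory.GaloisCohomology
open Literature.NumberTheory.GaloisRepresentations.DiscreteGaloisModule (SelmerStructure)
open Summit.BirchSwinnertonDyer.Rank1Residual.X11b Summit.BirchSwinnertonDyer.Rank1Residual.X11b.KummerPT
  Summit.BirchSwinnertonDyer.Rank1Residual.X11b.LocBridge Summit.BirchSwinnertonDyer.Rank1Residual.X5

/-- **(P1) THE POITOU–TATE COUNT relaxed-vs-strict at `v ∣ p`** (hand h10 of crux 19097's line `odd_blind_package`, slot CDC_H,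
binder `hglob` = (P1) + (P2); the type after `hPT` is the LEAD's `HTC7globPT_natCard_kummerRelaxed_eq` VERBATIM).  GIVEN the print
binder `hPT` (Poitou–Tate for Selmer structures with the real-place clause, Milne I Thm. 4.10 (b) / Ex. 1.6 (c)): for every
elliptic curve `E/ℚ`, prime `p`, finite place `v ∋ p` with `E(ℚ_v)[p] = 0` (and `E(ℚ)[p] = 0`, unused), and `J ≥ 1`,
`#H¹_{kummerRelaxed {v}}(ℚ, E[p^J]) = p^J · #H¹_{kummerStrict {v}}(ℚ, E[p^J])` — the X5 Kummer count
`[relaxed : strict] = #E(ℚ_v)[p^J] · #(𝓞_v/p^J) = 1 · p^J` (Kummer self-duality at every place, the real one by `hPT`'s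
`InjectiveAtRealPlaces`; Tate's local Euler characteristic is the tree's PROVED `localEulerPoincareCharacteristic_adicCompletionEP`).
CONDITIONAL on `hPT`; closes nothing; BSD is proved for no curve.
[cite: MilneADT2006, Ch. I, Example 1.6 (c), Thm. 2.8, Thm. 2.13, Cor. 3.4, Thm. 4.10 (b) and Lemma 6.15]
[cite: Howard2004HeegnerKolyvagin, Thm. 2.1.11 (arXiv:1202.6340 p. 6)] [cite: GreenbergLNM1716, §4 pp. 122–124] -/
theorem HTC7globPT_natCard_kummerRelaxed_eq
    (hPT : Literature.NumberTheory.GaloisCohomology.poitouTate_selmerStructure_duality_real ℚ) :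
    ∀ (E : WeierstrassCurve ℚ) [E.IsElliptic] (p : ℕ) [Fact p.Prime]
      (v : HeightOneSpectrum (𝓞 ℚ)), ((p : ℕ) : 𝓞 ℚ) ∈ v.asIdeal →
      (∀ P : (E.baseChange (v.adicCompletion ℚ)).toAffine.Point, p • P = 0 → P = 0) →
      (∀ P : E.toAffine.Point, p • P = 0 → P = 0) →
      ∀ J : ℕ, 1 ≤ J →
        Nat.card (SelmerStructure.selmerGroup (ρ := E.torsionGaloisModule ((p ^ J : ℕ) : ℤ))
            (KummerPT.kummerRelaxed E (p ^ J) {(Sum.inr v : Place ℚ)})) =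
          p ^ J * Nat.card (SelmerStructure.selmerGroup (ρ := E.torsionGaloisModule ((p ^ J : ℕ) : ℤ))
            (KummerPT.kummerStrict E (p ^ J) {(Sum.inr v : Place ℚ)})) := by
  intro E _ p _ v hv h0v _ J hJ
  have hp : p.Prime := Fact.out
  haveI : NeZero (p ^ J) := ⟨pow_ne_zero J hp.ne_zero⟩
  have hnpp : IsPrimePow (p ^ J) := hp.isPrimePow.pow (by omega)
  /- (1) the Poitou–Tate family at level `p^J` (print binder `hPT`, real-place clause `hreal` included) and Tate's local
  Euler–Poincaré characteristic at every finite place of `ℚ` (PROVED in the tree) -/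
  obtain ⟨inv, hperf, hvan, -, hcomp, hreal⟩ := hPT (p ^ J)
  have hEP : ∀ u : HeightOneSpectrum (𝓞 ℚ), localEulerPoincareCharacteristic (u.adicCompletion ℚ) := fun u ↦
    localEulerPoincareCharacteristic_adicCompletionEP ℚ u
  /- (2) THE X5 KUMMER COUNT: `[H¹_{relaxed {v}} : H¹_{strict {v}}] = #E(ℚ_v)[p^J] · #(𝓞_v / p^J)` -/
  have hidx := SelfDualCount.relIndex_kummerStrict_kummerRelaxed_singleton_eq E (p ^ J) hnpp inv hperf hvan hcomp
    hEP hreal v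
  /- (3) `E(ℚ_v)[p] = 0 ⟹ #E(ℚ_v)[p^J] = 1` -/
  have hker1 : Nat.card (nsmulAddMonoidHom (p ^ J) : (E.baseChange (v.adicCompletion ℚ)).toAffine.Point →+ _).ker = 1 := by
    have hk : (nsmulAddMonoidHom (p ^ J) : (E.baseChange (v.adicCompletion ℚ)).toAffine.Point →+ _).ker = ⊥ := by
      rw [eq_bot_iff]
      intro P hP
      rw [AddMonoidHom.mem_ker, nsmulAddMonoidHom_apply] at hP
      have hpow : ∀ (k : ℕ) (Q : (E.baseChange (v.adicCompletion ℚ)).toAffine.Point), p ^ k • Q = 0 → Q = 0 := by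
        intro k
        induction k with
        | zero => intro Q hQ; simpa using hQ
        | succ k ih => intro Q hQ; rw [pow_succ, mul_smul] at hQ; exact h0v Q (ih (p • Q) hQ)
      exact (AddSubgroup.mem_bot).2 (hpow J P hP)
    rw [hk, AddSubgroup.card_bot]
  /- (4) `#(𝓞_v / p^J) = p^J` (`𝓞_v ≅ ℤ_p`) -/
  have hq : Nat.card (v.adicCompletionIntegers ℚ ⧸ Ideal.span {((p ^ J : ℕ) : v.adicCompletionIntegers ℚ)}) = p ^ J :=
    natCard_adicCompletionIntegers_quotient_span_pow hv J
  rw [hker1, hq, one_mul] at hidx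
  /- (5) `#H¹_{strict} · [H¹_{relaxed} : H¹_{strict}] = #H¹_{relaxed}` (`⊥ ≤ H¹_{strict} ≤ H¹_{relaxed}`) -/
  have hsel : SelmerStructure.selmerGroup (ρ := E.torsionGaloisModule ((p ^ J : ℕ) : ℤ))
        (KummerPT.kummerStrict E (p ^ J) {(Sum.inr v : Place ℚ)}) ≤
      SelmerStructure.selmerGroup (ρ := E.torsionGaloisModule ((p ^ J : ℕ) : ℤ))
        (KummerPT.kummerRelaxed E (p ^ J) {(Sum.inr v : Place ℚ)}) := fun x hx ↦
    (SelmerStructure.mem_selmerGroup_iff _ _).2 fun u ↦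
      kummerStrict_le_kummerRelaxed E (p ^ J) _ u ((SelmerStructure.mem_selmerGroup_iff _ _).1 hx u)
  have hmul := AddSubgroup.relIndex_mul_relIndex ⊥ _ _ bot_le hsel
  rw [AddSubgroup.relIndex_bot_left, AddSubgroup.relIndex_bot_left, hidx] at hmul
  rw [← hmul, mul_comm]

end OddBlindLocal

end Summit.BirchSwinnertonDyer.BirchSwinnertonDyer.Theorems

end
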